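import Literature.Barriers.CriticalPhenomena.PlaquetteWalkHoleRootHoleColumnHook
import Literature.Barriers.CriticalPhenomena.PlaquetteWalkHoleRootSevenAboveClasses
import HarnessLib

/-!
# Barrier catalogue (SAWScalingLimit): in the HOLE COLUMN the straight level-`7` member has quarter turns `7`, turn classes forced by its two kisses, and PHASE INDEX
`1`, `4`, `6` or `1` («HOLE COLUMN: THE FOUR PHASES»)

`Z → ∞` limit model of the printed Yang–Baxter weights [GlazmanManolescu2019, §1, eq. (1)]; the «RECTANGLE COEFFICIENT» line (b-engine-1 g29), the CLASSES step of
the HOLE-COLUMN programme (FINDING-YB-HOLE-COLUMN-FOUR-PHASE, (H3a)). With the whole walk pinned (`ΩG.hook_of_cost_seven_straight_holeColumn_above`: hook prefix,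
loop under the hole, root-row passage with or without the kiss at `p₁`, climb with or without the hook kiss, top row into `T`), the turn bookkeeping of
`PlaquetteWalkAngleLimitPhase` closes:

* ★ `YBWalk.sum_qTurnOf_drop_eq_of_straight`: quarter turns do not change across a run of straight arcs.
* ★★★ `ΩG.quarterTurnsL_of_cost_seven_straight_holeColumn_above`: `q = 7` — prefix `+2` (the turns `W → N` at `p₁` and `S → W` at the hook), first arc `0`, wound
  excursion `woundTurns E W N = 5`.
* ★★★ `ΩG.classes_of_cost_seven_straight_holeColumn_above`: `n_{w₁} = [kiss at p₁]` (arcs `W → N`, `S → E`: a `w₁` plaquette, one `VR` arc), `n_{w₂} = [hook kiss]`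
  (arcs `S → W`, `E → N`: a `w₂` plaquette, one `HR` arc), `n_{VL} = 3 + [hook kiss]`, `n_{HR} = [hook kiss]`, `n_{VR} = [kiss at p₁]`; hence
  ★★★ `ΩG.phaseIndex_of_cost_seven_straight_holeColumn_above`: `phaseIndex = (9 + 3[kiss at p₁] + 5[hook kiss]) mod 8 ∈ {1, 4, 6}` (the two-kiss class returns to `1`).

[GlazmanManolescu2019 §1 Fig. 1, eq. (1), Lemma 2.1 (eq. (CR)), Remark 2.2, §2.1; Glazman2015WeightedSAW Lemma 3.1 (proof, pp. 6–7); Hopf1935 Nr. 2;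
CourantRobbins1958 Ch. V App. §2]
-/

noncomputable section

namespace Literature.Probability.RandomPlanarGeometry.SAW.YangBaxter

open Real
open Literature.Barriers.CriticalPhenomena.PlaquetteWalk

open private fc_fh fh_add_Mv three_le_Mv from Literature.Probability.RandomPlanarGeometry.YangBaxterSAWGeneralDomain
open private sOut_pred_eq_N from Literature.Barriers.CriticalPhenomena.PlaquetteWalkKissChains

namespace YBWalk

variable {D : Set Face} {a z : MidEdge} (γ : YBWalk D a z)

/-- ★ **QUARTER TURNS ACROSS A STRAIGHT RUN**: if the arcs `i, …, m − 1` are straight, the quarter turns from `i` on equal those from `m` on.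
[cite: GlazmanManolescu2019, §2.1 (the winding of a walk); lane plumbing] -/
theorem sum_qTurnOf_drop_eq_of_straight {i m : ℕ} (him : i ≤ m) (hm : m ≤ γ.arcs.length)
    (hstr : ∀ l, i ≤ l → l < m → arcKind (γ.sIn l) (γ.sOut l) = .straight) :
    ((γ.arcs.drop i).map qTurnOf).sum = ((γ.arcs.drop m).map qTurnOf).sum := by
  suffices H : ∀ d j : ℕ, j + d = m → i ≤ j → ((γ.arcs.drop j).map qTurnOf).sum = ((γ.arcs.drop m).map qTurnOf).sum from
    H (m - i) i (by omega) le_rfl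
  intro d
  induction d with
  | zero => intro j hj _; rw [Nat.add_zero] at hj; rw [hj]
  | succ d ih =>
    intro j hj hij
    have hj' : j < γ.arcs.length := by omega
    rw [List.drop_eq_getElem_cons hj', List.map_cons, List.sum_cons, ih (j + 1) (by omega) (by omega), γ.qTurnOf_getElem hj']
    have h0 : qTurn (γ.sIn j) (γ.sOut j) = 0 := by
      have := (qTurn_ne_zero_iff (γ.sIn_ne_sOut hj')).not; push Not at this
      exact this.2 (hstr j hij (by omega))
    rw [h0, zero_add]

end YBWalk

namespace ΩG

variable {D : Set Face} {w r : Face} {ω : ΩG D (w.side .W) r}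

/-- ★★★ **HOLE COLUMN: THE LEVEL-`7` MEMBER WINDS SEVEN QUARTER TURNS.** For a wound class-`B2a` walk of limit cost `7` from the hole root with a slanted end and a
straight first arc at a hole-column rhombus strictly above the hole, some arc above the row of `r`: `quarterTurnsL = 7` — the prefix turns left at `p₁` (`W → N`) and
at the hook (`S → W`), the first arc in `r` is straight, and the wound excursion winds `woundTurns E W N = 5`.
[cite: GlazmanManolescu2019, §2.1 (the winding); Lemma 2.1 (statement, «in the form given in [Gl]»)] [cite: Glazman2015WeightedSAW, Lemma 3.1 (proof, pp. 6–7)]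
[cite: Hopf1935, Nr. 2 (Umlaufsatz, p. 53)] -/
theorem quarterTurnsL_of_cost_seven_straight_holeColumn_above (hh : holeFaceW w ∉ D) (hr : RootedFace D (w.side .W) r) (h : ω.IsB2a)
    (hA : ω.AJ hr h (toC (midPt (w.side .W))) ≠ 0) (hc : cost (slotOfSide ω.1) ω.2.mids = 7) (hz : ω.1 = .N ∨ ω.1 = .S)
    (hstr8 : arcKind (ω.2.sIn ω.2.firstHitG) (ω.2.sOut ω.2.firstHitG) = .straight) (hcol : r.1 = w.1 - 1) (habove : w.2 < r.2)
    (hup : ∃ j < ω.2.arcs.length, r.2 < (ω.2.fc j).2) : quarterTurnsL ω.2.mids = 7 := by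
  classical
  set n := ω.2.arcs.length with hn
  have hF := ω.fh_lt h
  obtain ⟨c₂, c₁, Y, Y', τ1, k₀, MW, ME, k₁, t₂, -, -, -, -, -, -, -, -, -, -, -, -, -, -, -, -, -, hN1, -, -, -, -, -, -, -, -, -, hk₁F, hstr, hk₁ns,
    hfk, hWk, -, -, -, -, -, hinF, houtF, -, -, -, -, -, -, -, -, -, -, -, -, -, -, hk₁N, hcolrun, houth, hrowrun, hFeq, -, -, -, -⟩ :=
    hook_of_cost_seven_straight_holeColumn_above hh hr h hA hc hz hstr8 hcol habove hup
  obtain ⟨dM, hdM⟩ : ∃ dM : ℕ, (dM : ℤ) = r.2 - w.2 - 1 := ⟨(r.2 - w.2 - 1).toNat, by omega⟩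
  have eM : (r.2 - w.2).toNat = dM + 1 := by
    have e : r.2 - w.2 = ((dM + 1 : ℕ) : ℤ) := by push_cast; omega
    rw [e, Int.toNat_natCast]
  rw [eM] at houth hrowrun hFeq
  clear eM
  set jh := k₁ + (dM + 1) with hjh
  -- the arcs strictly between `p₁` and the hook, and strictly between the hook and `r`, are straight
  have hstr1 : ∀ l, l < jh → l ≠ k₁ → arcKind (ω.2.sIn l) (ω.2.sOut l) = .straight := by
    intro l hl hlk
    rcases Nat.lt_or_ge l k₁ with hlt | hge
    · exact hstr l hlt
    · -- a column arc: entered from `S`, and the next arc is entered from `S`, so this one leaves through `N`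
      obtain ⟨m, hm⟩ : ∃ m : ℕ, l = k₁ + m := ⟨l - k₁, by omega⟩
      subst hm
      have hm1 : 1 ≤ m := by omega
      obtain ⟨-, hin⟩ := hcolrun m hm1 (by omega)
      obtain ⟨-, hin'⟩ := hcolrun (m + 1) (by omega) (by omega)
      have hout := sOut_pred_eq_N ω.2 (i := k₁ + (m + 1)) (by omega) (by omega) hin'
      rw [show k₁ + (m + 1) - 1 = k₁ + m by omega] at hout
      rw [hin, hout]; decide
  have hstr2 : ∀ l, jh + 1 ≤ l → l < ω.2.firstHitG → arcKind (ω.2.sIn l) (ω.2.sOut l) = .straight := by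
    intro l hl1 hl2
    obtain ⟨m, hm⟩ : ∃ m : ℕ, l = jh + m := ⟨l - jh, by omega⟩
    subst hm
    have hm1 : 1 ≤ m := by omega
    obtain ⟨-, hin⟩ := hrowrun m hm1 (by omega)
    -- the next arc (index `jh + m + 1 ≤ F`) is entered from `E`, so this one leaves through `W`
    have hnext : ω.2.sIn (jh + m + 1) = .E := by
      rcases Nat.lt_or_ge (jh + m + 1) ω.2.firstHitG with hlt | hge
      · exact (hrowrun (m + 1) (by omega) (by omega)).2
      · have : jh + m + 1 = ω.2.firstHitG := by omega
        rw [this]; exact hinF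
    have hout := (ω.2.fc_pred_eq_of_sIn_E (i := jh + m + 1) (by omega) (by omega) hnext).2
    rw [show jh + m + 1 - 1 = jh + m by omega] at hout
    rw [hin, hout]; decide
  -- quarter turns: prefix `+2`, first arc `0`, excursion `5`
  have hjhF : jh < ω.2.firstHitG := by omega
  have h1 := ω.2.sum_qTurnOf_drop_of_one_turn (k := k₁) (m := jh) (by omega) (by omega) (fun i hi hik => hstr1 i hi hik) 0 (Nat.zero_le _)
  rw [if_pos (Nat.zero_le _), hWk, hk₁N] at h1
  obtain ⟨-, hinh⟩ := hcolrun (dM + 1) (by omega) (by push_cast; omega)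
  rw [hinh, houth] at h1
  have h2 := ω.2.sum_qTurnOf_drop_eq_of_straight (i := jh + 1) (m := ω.2.firstHitG) (by omega) (by omega) hstr2
  have h3 : ((ω.2.arcs.drop ω.2.firstHitG).map qTurnOf).sum = ((ω.2.arcs.drop (ω.2.firstHitG + 1)).map qTurnOf).sum := by
    rw [List.drop_eq_getElem_cons hF, List.map_cons, List.sum_cons, ω.2.qTurnOf_getElem hF]
    have h0 : qTurn (ω.2.sIn ω.2.firstHitG) (ω.2.sOut ω.2.firstHitG) = 0 := by rw [hinF, houtF]; rfl
    rw [h0, zero_add]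
  have hexc := excursion_quarterTurns_of_wound hr h hA
  obtain ⟨-, hf2, hf3⟩ := fc_fh' ω hr h
  have hwt : woundTurns Side.E Side.W ω.1 = 5 := by rw [hN1]; rfl
  rw [← hf2, ← hf3, hinF, houtF, hwt] at hexc
  unfold quarterTurnsL
  change ((ω.2.arcs.drop 0).map qTurnOf).sum = 7
  rw [h1, h2, h3, hexc]; rfl

/-- ★★★ **HOLE COLUMN: THE TURN CLASSES OF THE LEVEL-`7` MEMBER.** In the setting of `hook_of_cost_seven_straight_holeColumn_above`, with `a = 1` if the loop returns through
the first turning plaquette `p₁` (a `w₁` kiss: arcs `W → N`, `S → E`) else `0`, and `b = 1` if the climb passes through the hook plaquette (a `w₂` kiss: arcs `S → W`,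
`E → N`) else `0`: `n_{w₁} = a`, `n_{w₂} = b`, `n_{VR} = a`, `n_{HR} = b`, `n_{VL} = 3 + b`, `n_{HL} = 4 + a`. [cite: GlazmanManolescu2019, §1, Fig. 1 and eq. (1); Lemma 2.1;
Remark 2.2] [cite: Glazman2015WeightedSAW, Lemma 3.1 (proof, pp. 6–7)] -/
theorem classes_of_cost_seven_straight_holeColumn_above (hh : holeFaceW w ∉ D) (hr : RootedFace D (w.side .W) r) (h : ω.IsB2a)
    (hA : ω.AJ hr h (toC (midPt (w.side .W))) ≠ 0) (hc : cost (slotOfSide ω.1) ω.2.mids = 7) (hz : ω.1 = .N ∨ ω.1 = .S)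
    (hstr8 : arcKind (ω.2.sIn ω.2.firstHitG) (ω.2.sOut ω.2.firstHitG) = .straight) (hcol : r.1 = w.1 - 1) (habove : w.2 < r.2)
    (hup : ∃ j < ω.2.arcs.length, r.2 < (ω.2.fc j).2) :
    ∃ a b : ℕ, a ≤ 1 ∧ b ≤ 1 ∧
      ((a = 1 ↔ ∃ l l' : ℕ, l < ω.2.arcs.length ∧ l' < ω.2.arcs.length ∧ l ≠ l' ∧ ω.2.fc l = ω.2.fc l' ∧ (ω.2.fc l).2 = w.2) ∧
        (b = 1 ↔ ∃ l l' : ℕ, l < ω.2.arcs.length ∧ l' < ω.2.arcs.length ∧ l ≠ l' ∧ ω.2.fc l = ω.2.fc l' ∧ (ω.2.fc l).2 = r.2)) ∧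
      cfgCount ω.2.mids [.corner, .corner] = a ∧ cfgCount ω.2.mids [.coCorner, .coCorner] = b ∧
      vrCount ω.2.mids = a ∧ hrCount ω.2.mids = b ∧ vlCount ω.2.mids = 3 + b ∧ hlCount ω.2.mids = 4 + a := by
  classical
  set n := ω.2.arcs.length with hn
  have hF := ω.fh_lt h
  have hq := quarterTurnsL_of_cost_seven_straight_holeColumn_above hh hr h hA hc hz hstr8 hcol habove hup
  obtain ⟨c₂, c₁, Y, Y', τ1, k₀, MW, ME, k₁, t₂, hY, hY', hr₃, hY'w, ht₂row, ht₂col, hτ1w, hMW1, hME1, hEW, hWW, hnotW, hWE, hEE, hnotE,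
    hseven, hall, hN1, hL, hLS, hdesc, hdescIn, heWS, heWnN, hlegN, hlegS, hbWnS, hk₁F, hstr, hk₁ns, hfk, hWk, hk₀w, hbotS, hbWnW, hbEnE, hbEnS,
    hinF, houtF, hrunR, hrunL, hrunB, hrunE, hi₀n, hpass, hclimb, hi₁n, ht₂, hTin, hMT, hrunT, hrunTin, htop,
    hk₁N, hcolrun, houth, hrowrun, hFeq, hME, hidxp, hidxh, hkiss⟩ :=
    hook_of_cost_seven_straight_holeColumn_above hh hr h hA hc hz hstr8 hcol habove hup
  -- hide disjunctions and `toNat` atoms from `omega`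
  have hpassF := Fact.mk hpass
  have htopF := Fact.mk htop
  have hi₀nF := Fact.mk hi₀n
  have hi₁nF := Fact.mk hi₁n
  clear hpass htop hi₀n hi₁n hMT ht₂col hclimb hrunT hrunTin hTin hrunR hrunL hrunB hdesc hdescIn
  have hc₁x : w.1 + (k₁ : ℤ) < c₁ := by rcases hpassF.out with ⟨e1, e2, e3, -⟩ | ⟨e1, -, e3, -⟩ <;> omega
  obtain ⟨dB, hdB⟩ : ∃ dB : ℕ, (dB : ℤ) = w.2 - Y' - 1 := ⟨(w.2 - Y' - 1).toNat, by omega⟩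
  obtain ⟨dR, hdR⟩ : ∃ dR : ℕ, (dR : ℤ) = k₀ - (r.1 - MW) - 1 := ⟨(k₀ - (r.1 - MW) - 1).toNat, by omega⟩
  obtain ⟨dL, hdL⟩ : ∃ dL : ℕ, (dL : ℤ) = r.2 - Y' - 1 := ⟨(r.2 - Y' - 1).toNat, by omega⟩
  obtain ⟨dM, hdM⟩ : ∃ dM : ℕ, (dM : ℤ) = r.2 - w.2 - 1 := ⟨(r.2 - w.2 - 1).toNat, by omega⟩
  obtain ⟨dT, hdT⟩ : ∃ dT : ℕ, (dT : ℤ) = Y - r.2 - 1 := ⟨(Y - r.2 - 1).toNat, by omega⟩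
  obtain ⟨dC, hdC⟩ : ∃ dC : ℕ, (dC : ℤ) = c₁ - k₀ := ⟨(c₁ - k₀).toNat, by rcases hpassF.out with ⟨e1, e2, e3, -⟩ | ⟨e1, -, e3, -⟩ <;> omega⟩
  obtain ⟨dH, hdH⟩ : ∃ dH : ℕ, (dH : ℤ) = c₁ - (w.1 + k₁) - 1 := ⟨(c₁ - (w.1 + k₁) - 1).toNat, by omega⟩
  obtain ⟨d₂, hd₂⟩ : ∃ d₂ : ℕ, (d₂ : ℤ) = c₂ - r.1 := ⟨(c₂ - r.1).toNat, by rcases htopF.out with ⟨e, -⟩ | ⟨e, -⟩ <;> omega⟩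
  have htoNat : ∀ (a : ℤ) (k : ℕ), a = k → a.toNat = k := fun a k e => by subst e; exact Int.toNat_natCast k
  have eLF : Fact ((r.2 - Y').toNat = dL + 1) := ⟨htoNat _ _ (by push_cast; omega)⟩
  have eRF : Fact ((k₀ - (r.1 - MW)).toNat = dR + 1) := ⟨htoNat _ _ (by push_cast; omega)⟩
  have eBF : Fact ((w.2 - Y').toNat = dB + 1) := ⟨htoNat _ _ (by push_cast; omega)⟩
  have eCF : Fact ((c₁ - k₀).toNat = dC) := ⟨htoNat _ _ (by omega)⟩
  have eMF : Fact ((r.2 - w.2).toNat = dM + 1) := ⟨htoNat _ _ (by push_cast; omega)⟩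
  have eTF : Fact ((Y - r.2 - 1).toNat = dT) := ⟨htoNat _ _ (by omega)⟩
  have eT1F : Fact ((Y - r.2).toNat = dT + 1) := ⟨htoNat _ _ (by push_cast; omega)⟩
  have e₂F : Fact ((c₂ - r.1).toNat = d₂) := ⟨htoNat _ _ (by omega)⟩
  have eHF : Fact ((c₁ - (w.1 + (k₁ : ℤ))).toNat = dH + 1) := ⟨htoNat _ _ (by push_cast; omega)⟩
  obtain ⟨i₀, hi₀⟩ : ∃ i₀ : ℕ, ω.2.firstHitG + MW + (dL + 1) + (dR + 1) + (dB + 1) = i₀ := ⟨_, rfl⟩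
  obtain ⟨i₁, hi₁⟩ : ∃ i₁ : ℕ, i₀ + dC + (dM + 1) = i₁ := ⟨_, rfl⟩
  obtain ⟨jh, hjh⟩ : ∃ jh : ℕ, k₁ + (dM + 1) = jh := ⟨_, rfl⟩
  have hIDX0F : Fact (ω.2.firstHitG + MW + (r.2 - Y').toNat + (k₀ - (r.1 - MW)).toNat + (w.2 - Y').toNat = i₀) :=
    ⟨by rw [eLF.out, eRF.out, eBF.out]; exact hi₀⟩
  have hIDX1F : Fact (ω.2.firstHitG + MW + (r.2 - Y').toNat + (k₀ - (r.1 - MW)).toNat + (w.2 - Y').toNat + (c₁ - k₀).toNat +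
      (r.2 - w.2).toNat = i₁) := ⟨by rw [eLF.out, eRF.out, eBF.out, eCF.out, eMF.out]; omega⟩
  rw [eLF.out, eRF.out] at hrunE
  have hi₀n := hi₀nF.out
  rw [hIDX0F.out] at hi₀n
  have hi₁n := hi₁nF.out
  rw [hIDX1F.out] at hi₁n
  rw [eMF.out, hjh] at houth hrowrun hFeq
  rw [hIDX0F.out] at hidxp
  rw [hIDX1F.out, eHF.out, eMF.out, hjh] at hidxh
  clear hi₀nF hi₁nF
  -- the arrival arcs: at `q = fc i₀` (entered `S`), at the hook `fc jh` (entered `S`, left `W`)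
  obtain ⟨hfcq, hinq⟩ := hrunE (dB + 1) (by omega) (by push_cast; omega)
  rw [show ω.2.firstHitG + MW + (dL + 1) + (dR + 1) + (dB + 1) = i₀ from hi₀] at hfcq hinq
  obtain ⟨hfch, hinh⟩ := hcolrun (dM + 1) (by omega) (by push_cast; omega)
  rw [hjh] at hfch hinh
  have hjhn : jh < n := by omega
  -- case (I): the loop leaves `p₁` through `E`; case (b): the arrival at the hook `E → N`
  have hqE : k₀ = w.1 + k₁ → ω.2.sOut i₀ = .E := by
    intro hk
    rcases hpassF.out with ⟨-, -, -, -, hqE, -⟩ | ⟨hlt, -⟩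
    · rw [hIDX0F.out] at hqE; exact hqE
    · omega
  have hharr : c₂ = w.1 + k₁ → i₁ + (dH + 1) < n ∧ ω.2.sIn (i₁ + (dH + 1)) = .E ∧ ω.2.sOut (i₁ + (dH + 1)) = .N ∧
      ω.2.fc (i₁ + (dH + 1)) = (w.1 + k₁, r.2) := by
    intro hk
    rcases htopF.out with ⟨hcc', -⟩ | ⟨-, -, -, hrunH, houtH, -, hidx⟩
    · omega
    · rw [hIDX1F.out] at hrunH
      rw [hIDX1F.out, eHF.out] at houtH
      rw [hIDX1F.out, eHF.out, eT1F.out, eTF.out, e₂F.out] at hidx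
      obtain ⟨efc, einh⟩ := hrunH (dH + 1) (by omega) (by push_cast; omega)
      have hlt : i₁ + (dH + 1) < n := by
        have := hidx; clear hidx
        omega
      exact ⟨hlt, einh, houtH, by rw [efc]; exact Prod.ext (by simp only; push_cast; omega) rfl⟩
  clear eLF eRF eBF eCF eMF eTF eT1F e₂F eHF hIDX0F hIDX1F
  -- the two kiss indicators
  obtain ⟨a, ha⟩ : ∃ a : ℕ, a = if k₀ = w.1 + (k₁ : ℤ) then 1 else 0 := ⟨_, rfl⟩
  obtain ⟨b, hb⟩ : ∃ b : ℕ, b = if c₂ = w.1 + (k₁ : ℤ) then 1 else 0 := ⟨_, rfl⟩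
  have ha1 : a ≤ 1 := by rw [ha]; split_ifs <;> omega
  have hb1 : b ≤ 1 := by rw [hb]; split_ifs <;> omega
  ---------------------------------------------------------------- the bookkeeping identities
  have hqc := quarterTurnsL_eq_classes ω.2.mids
  rw [hq] at hqc
  have htel := hvCount_sub_vhCount_walk ω.2
  obtain ⟨hhv, hvh⟩ := hvCount_eq ω.2
  have hzv : vertB (r.side ω.1) = false := by rw [hN1]; exact (vertB_side r).2.2.2
  rw [hhv, hvh, (vertB_side w).1, hzv] at htel
  have htel' : ((hlCount ω.2.mids + hrCount ω.2.mids : ℕ) : ℤ) - ((vlCount ω.2.mids + vrCount ω.2.mids : ℕ) : ℤ) = 1 := by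
    rw [htel]; simp
  clear htel
  have hc1 := countP_corner_eq ω.2.mids
  rw [countP_corner_eq_cfgCount ω.2] at hc1
  have hc2 := countP_coCorner_eq ω.2.mids
  rw [countP_coCorner_eq_cfgCount ω.2] at hc2
  have hd : slotDeg (slotOfSide ω.1) = 1 := by rw [hN1]; rfl
  have h7 : cfgCount ω.2.mids [.corner] + cfgCount ω.2.mids [.coCorner] = 7 := by
    have hcost : cost (slotOfSide ω.1) ω.2.mids =
        cfgCount ω.2.mids [.corner] + cfgCount ω.2.mids [.coCorner] + (1 - slotDeg (slotOfSide ω.1)) := rfl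
    rw [hcost, hd] at hc; omega
  ---------------------------------------------------------------- the doubly visited plaquettes are `p₁` (iff `a = 1`) and the hook (iff `b = 1`)
  have hdouble : ∀ f : Face, f ∈ facesL ω.2.mids → (kindsL ω.2.mids f).length = 2 →
      (f = (w.1 + k₁, w.2) ∧ k₀ = w.1 + k₁) ∨ (f = (w.1 + k₁, r.2) ∧ c₂ = w.1 + k₁) := by
    intro f hf hlen
    obtain ⟨m, hm, rfl⟩ := ω.2.exists_fc_eq_of_mem_facesL hf
    by_cases hsv : ∀ j < n, ω.2.fc j = ω.2.fc m → j = m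
    · rw [ω.2.kindsL_eq_singleton_of_single_visit hm hsv] at hlen; exact absurd hlen (by simp)
    · push Not at hsv
      obtain ⟨j, hj, hfj, hjm⟩ := hsv
      exact hkiss m j hm hj hfj.symm (Ne.symm hjm)
  -- the arcs at `p₁` are `corner`s, those at the hook `coCorner`s
  have hp₁corner : ∀ l < n, ω.2.fc l = (w.1 + k₁, w.2) → arcKind (ω.2.sIn l) (ω.2.sOut l) = .corner := by
    intro l hl hfl
    rcases hidxp l hl hfl with e | ⟨hk, e⟩
    · rw [e, hWk, hk₁N]; rfl
    · rw [e, hinq, hqE hk]; rfl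
  have hhcoCorner : ∀ l < n, ω.2.fc l = (w.1 + k₁, r.2) → arcKind (ω.2.sIn l) (ω.2.sOut l) = .coCorner := by
    intro l hl hfl
    rcases hidxh l hl hfl with e | ⟨hk, e⟩
    · rw [e, hinh, houth]; rfl
    · obtain ⟨-, hin, hout, -⟩ := hharr hk
      rw [e, hin, hout]; rfl
  have hcount : ∀ (c : Face) (κ : ArcKind), (∀ l < n, ω.2.fc l = c → arcKind (ω.2.sIn l) (ω.2.sOut l) ≠ κ) →
      ∀ f ∈ facesL ω.2.mids, kindsL ω.2.mids f = [κ, κ] → f ≠ c := by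
    intro c κ hno f hf hkf hfc
    obtain ⟨l, hl, hfl, hkl⟩ := ω.2.exists_arc_of_mem_kindsL (show κ ∈ kindsL ω.2.mids f by rw [hkf]; simp)
    exact hno l hl (hfl.trans hfc) hkl
  have hle_one : ∀ (c : Face), (facesL ω.2.mids).countP (fun f => f = c) ≤ 1 := by
    intro c
    rw [show (facesL ω.2.mids).countP (fun f => f = c) = (facesL ω.2.mids).count c by
      rw [List.count_eq_countP]; exact List.countP_congr fun f _ => by simp only [decide_eq_true_eq, beq_iff_eq]]
    exact List.nodup_iff_count_le_one.1 (by unfold facesL; exact List.nodup_dedup _) _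
  have hw1 : cfgCount ω.2.mids [.corner, .corner] ≤ a := by
    by_cases hk : k₀ = w.1 + k₁
    · rw [ha, if_pos hk]
      unfold cfgCount
      refine le_trans (List.countP_mono_left fun f hf hkf => ?_) (hle_one (w.1 + k₁, w.2))
      have hkf' : kindsL ω.2.mids f = [.corner, .corner] := by simpa using hkf
      rcases hdouble f hf (by rw [hkf']; rfl) with ⟨h1, -⟩ | ⟨h2, -⟩
      · simpa using h1
      · exact absurd h2 (hcount _ _ (fun l hl hfl => by rw [hhcoCorner l hl hfl]; decide) f hf hkf')
    · rw [ha, if_neg hk]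
      unfold cfgCount
      rw [Nat.le_zero, List.countP_eq_zero]
      intro f hf hkf
      have hkf' : kindsL ω.2.mids f = [.corner, .corner] := by simpa using hkf
      rcases hdouble f hf (by rw [hkf']; rfl) with ⟨-, hk'⟩ | ⟨h2, -⟩
      · exact hk hk'
      · exact hcount _ _ (fun l hl hfl => by rw [hhcoCorner l hl hfl]; decide) f hf hkf' h2
  have hw2 : cfgCount ω.2.mids [.coCorner, .coCorner] ≤ b := by
    by_cases hk : c₂ = w.1 + k₁
    · rw [hb, if_pos hk]
      unfold cfgCount
      refine le_trans (List.countP_mono_left fun f hf hkf => ?_) (hle_one (w.1 + k₁, r.2))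
      have hkf' : kindsL ω.2.mids f = [.coCorner, .coCorner] := by simpa using hkf
      rcases hdouble f hf (by rw [hkf']; rfl) with ⟨h1, -⟩ | ⟨h2, -⟩
      · exact absurd h1 (hcount _ _ (fun l hl hfl => by rw [hp₁corner l hl hfl]; decide) f hf hkf')
      · simpa using h2
    · rw [hb, if_neg hk]
      unfold cfgCount
      rw [Nat.le_zero, List.countP_eq_zero]
      intro f hf hkf
      have hkf' : kindsL ω.2.mids f = [.coCorner, .coCorner] := by simpa using hkf
      rcases hdouble f hf (by rw [hkf']; rfl) with ⟨h1, -⟩ | ⟨-, hk'⟩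
      · exact hcount _ _ (fun l hl hfl => by rw [hp₁corner l hl hfl]; decide) f hf hkf' h1
      · exact hk hk'
  ---------------------------------------------------------------- the kiss arcs: a `VR` arc at `p₁`, an `HR` arc at the hook
  have hvr : a ≤ vrCount ω.2.mids := by
    by_cases hk : k₀ = w.1 + k₁
    · rw [ha, if_pos hk]
      unfold vrCount classCount
      refine List.countP_pos_iff.2 ⟨ω.2.arcs[i₀]'hi₀n, List.getElem_mem hi₀n, ?_⟩
      rw [ω.2.arcSides_getElem hi₀n, hinq, hqE hk]; rfl
    · rw [ha, if_neg hk]; omega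
  have hhr : b ≤ hrCount ω.2.mids := by
    by_cases hk : c₂ = w.1 + k₁
    · rw [hb, if_pos hk]
      obtain ⟨hiH, hin, hout, -⟩ := hharr hk
      unfold hrCount classCount
      refine List.countP_pos_iff.2 ⟨ω.2.arcs[i₁ + (dH + 1)]'hiH, List.getElem_mem hiH, ?_⟩
      rw [ω.2.arcSides_getElem hiH, hin, hout]; rfl
    · rw [hb, if_neg hk]; omega
  ---------------------------------------------------------------- solve
  have hl_eq : (hlCount ω.2.mids : ℤ) = vrCount ω.2.mids + 4 := by omega
  have vl_eq : (vlCount ω.2.mids : ℤ) = hrCount ω.2.mids + 3 := by omega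
  have hsum : vrCount ω.2.mids + hrCount ω.2.mids = cfgCount ω.2.mids [.corner, .corner] + cfgCount ω.2.mids [.coCorner, .coCorner] := by omega
  have hw1' : cfgCount ω.2.mids [.corner, .corner] = a := by omega
  have hw2' : cfgCount ω.2.mids [.coCorner, .coCorner] = b := by omega
  have hvr' : vrCount ω.2.mids = a := by omega
  have hhr' : hrCount ω.2.mids = b := by omega
  refine ⟨a, b, ha1, hb1, ⟨?_, ?_⟩, hw1', hw2', hvr', hhr', by omega, by omega⟩
  · constructor
    · intro ha'
      have hk : k₀ = w.1 + k₁ := by by_contra hk; rw [ha, if_neg hk] at ha'; omega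
      exact ⟨k₁, i₀, by omega, hi₀n, by omega, by rw [hfk, hfcq, hk]; exact Prod.ext rfl (by simp only; omega), by rw [hfk]⟩
    · rintro ⟨l, l', hl, hl', hne, hfl, hrow⟩
      rcases hkiss l l' hl hl' hfl hne with ⟨-, hk⟩ | ⟨hf, -⟩
      · rw [ha, if_pos hk]
      · rw [hf] at hrow; simp only at hrow; omega
  · constructor
    · intro hb'
      have hk : c₂ = w.1 + k₁ := by by_contra hk; rw [hb, if_neg hk] at hb'; omega
      obtain ⟨hiH, -, -, hfcH⟩ := hharr hk
      refine ⟨jh, _, hjhn, hiH, by omega, ?_, by rw [hfch]; simp only; push_cast; omega⟩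
      rw [hfch, hfcH]; exact Prod.ext rfl (by simp only; push_cast; omega)
    · rintro ⟨l, l', hl, hl', hne, hfl, hrow⟩
      rcases hkiss l l' hl hl' hfl hne with ⟨hf, -⟩ | ⟨-, hk⟩
      · rw [hf] at hrow; simp only at hrow; omega
      · rw [hb, if_pos hk]

/-- ★★★ **HOLE COLUMN: THE PHASE INDEX OF THE LEVEL-`7` MEMBER.** In the setting of `hook_of_cost_seven_straight_holeColumn_above`, with the kiss indicators `a` (the loop
returns through the first turning plaquette) and `b` (the climb passes through the hook): `phaseIndex = (3(n_{VL} + n_{w₁}) + 2n_{w₂}) mod 8 = (9 + 3a + 5b) mod 8`, i.e.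
`1` (no kiss), `4` (kiss at `p₁` only), `6` (hook kiss only), `1` (both). [cite: GlazmanManolescu2019, §1, Fig. 1 and eq. (1); Lemma 2.1, eq. (CR); Remark 2.2]
[cite: Glazman2015WeightedSAW, Lemma 3.1 (proof, pp. 6–7)] -/
theorem phaseIndex_of_cost_seven_straight_holeColumn_above (hh : holeFaceW w ∉ D) (hr : RootedFace D (w.side .W) r) (h : ω.IsB2a)
    (hA : ω.AJ hr h (toC (midPt (w.side .W))) ≠ 0) (hc : cost (slotOfSide ω.1) ω.2.mids = 7) (hz : ω.1 = .N ∨ ω.1 = .S)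
    (hstr8 : arcKind (ω.2.sIn ω.2.firstHitG) (ω.2.sOut ω.2.firstHitG) = .straight) (hcol : r.1 = w.1 - 1) (habove : w.2 < r.2)
    (hup : ∃ j < ω.2.arcs.length, r.2 < (ω.2.fc j).2) :
    ∃ a b : ℕ, a ≤ 1 ∧ b ≤ 1 ∧
      ((a = 1 ↔ ∃ l l' : ℕ, l < ω.2.arcs.length ∧ l' < ω.2.arcs.length ∧ l ≠ l' ∧ ω.2.fc l = ω.2.fc l' ∧ (ω.2.fc l).2 = w.2) ∧
        (b = 1 ↔ ∃ l l' : ℕ, l < ω.2.arcs.length ∧ l' < ω.2.arcs.length ∧ l ≠ l' ∧ ω.2.fc l = ω.2.fc l' ∧ (ω.2.fc l).2 = r.2)) ∧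
      phaseIndex ω.2.mids = (9 + 3 * a + 5 * b) % 8 := by
  obtain ⟨a, b, ha, hb, hab, hw1, hw2, -, -, hvl, -⟩ := classes_of_cost_seven_straight_holeColumn_above hh hr h hA hc hz hstr8 hcol habove hup
  refine ⟨a, b, ha, hb, hab, ?_⟩
  unfold phaseIndex
  rw [hvl, hw1, hw2]
  omega

end ΩG

end Literature.Probability.RandomPlanarGeometry.SAW.YangBaxter
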